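import Literature.NumberTheory.EllipticCurves.HeegnerPoints
import HarnessLib

/-!
# Imaginary quadratic fields with class number prime to `ℓ` and prescribed SPLIT primes
# (Beckwith–Raum–Richter, IMRN 2024, Theorem 1)

The class-wide SUPPLY theorem for the auxiliary field of the Eisenstein-prime roads of cell
`bsd-eis` (route `EisensteinPrimes`, crux 2 `GoodLatticeBDPValue`: Rubin's standing hypothesis
«`p ∤ h_K`» of the two-variable main conjecture, the selection constraint (F1) of the planner's
RULING L17 (2); crux 5 `MazurMCOnX1RankZero`: the admissible `(K, K′)` of the double-twist road) —
as PRINTED, one named fact and its Heegner-hypothesis corollaries in the tree's currency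
(`IsImaginaryQuadratic`, `SatisfiesHeegnerHypothesis` of
`Literature/NumberTheory/EllipticCurves/HeegnerPoints.lean`; Mathlib `NumberField.classNumber`).

## The printed statement (verbatim; text held as `paper:arxiv-2305.19272`, chunk p0002 L23–L29;
## journal version Int. Math. Res. Not. IMRN 2024, no. 16, 11582–11596, doi:10.1093/imrn/rnae130,
## Theorem 1 of the Introduction)

«Throughout, we write `h(−D)` for the class number of the quadratic field of discriminant `−D`.
**Theorem 1.** Let `ℓ ≥ 2` be a prime and `S₊` a finite set of odd primes. Then there exists an
imaginary quadratic field `L` satisfying • the class number `h_L` of `L` is prime to `ℓ`;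
• `L` is split at each prime of `S₊`.»

Context printed on the same page (p0002 L17–L19): Hartung (infinitely many imaginary quadratic
fields with `ℓ`-torsion-free class group), Bruinier 1999 (local conditions at primes
`≢ ±1, 0 (mod ℓ)`), «In 2015, Wiles provided an existence theorem of a similar flavor …: there exist
imaginary quadratic fields without `ℓ`-torsion in their class groups that are split at a finite set
of odd primes `S₊`, inert at a finite set of odd primes `S₋`, and ramified at a finite set of odd
primes `S₀`. Such a result also has applications to, for instance, canonical periods of elliptic
curves (see Corollary 3.4 of [vatsal-1999])»; «Note that the sets `S₊`, `S₋`, and `S₀` in Wiles's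
theorem cannot be chosen arbitrarily. For example, the primes `p ∈ S₊` must satisfy
`p ≢ −1 (mod ℓ)` … The purpose of the present work is to present a new method that likewise allows
to discard any conditions on the primes in `S₊` but still applies to all primes `ℓ`.» Wiles's
theorem, for comparison (J. Lond. Math. Soc. 92 (2015), Thm. 0.0.1, held
`paper:wiles2015-class-groups-imaginary-quadratic-fields` p0001 L13–L24): «Let `l ⩾ 3` be an odd
prime. Let `S = S₊ ∪ S₀ ∪ S₋` be a disjoint union of finite sets of odd primes. Assume that (a) `S₋`
contains no prime `q` with `q ≡ 1 (l)` and `q ≡ −1 (4)`. (b) `S₊` contains no prime with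
`q ≡ −1 (l)`. (c) `S₀` contains no prime with `q ≡ 1 (l)`. Then there exists an imaginary quadratic
field `L` satisfying (i) the class number `h_L` of `L` is prime to `l`. (ii) `L` is ramified at
each prime of `S₀`, inert at each prime of `S₋` and split at each prime of `S₊`.» — NOT typed here
(its split clause is subsumed by Theorem 1; no consumer of the inert/ramified prescriptions).

SCOPE, exactly as printed: EXISTENCE of one field (iterate with a larger `S₊` for more); the primes
of `S₊` are ODD — splitting at `2` (needed for the Heegner hypothesis of an EVEN conductor) is not
supplied by this theorem; no condition `d_L ≡ 1 (mod 8)`, `|d_L| > 4`, and no statement about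
`L`-values or Heegner points of any curve over `L`.

Typed by the bsd-eis literature seat (g20) on the planner's RULING L17 (2) («a K-supply theorem …
typed as a Literature fact ONLY if/when refereed» — it is: IMRN 2024). Cell dossier
`run/shared/lean/pub/bsd-eis/LIT-DOSSIER.md` §51 (G)/(G′).
-/

open scoped NumberField

open NumberField Literature.NumberTheory.EllipticCurves

namespace Literature.NumberTheory.QuadraticFields.BeckwithRaumRichter2024

/-- **Beckwith–Raum–Richter, IMRN 2024, Theorem 1** (as printed): for every prime `ℓ ≥ 2` and
every finite set `S₊` of ODD primes there is an imaginary quadratic field `L` (`[L:ℚ] = 2`, totally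
complex — `IsImaginaryQuadratic`) whose class number is prime to `ℓ` and in which every prime of
`S₊` splits (exactly two primes of `𝓞 L` above `q`, the clause of `SatisfiesHeegnerHypothesis`).
Named fact (statement only; proved in print via non-holomorphic Ramanujan-type congruences for
Hurwitz class numbers and Serre's theorem).
[cite: BeckwithRaumRichter2024, Theorem 1 (Introduction, IMRN 2024:16 pp. 11582–11583; held text
`paper:arxiv-2305.19272` chunk p0002 L23–L29)] -/
def thm1_exists_imaginaryQuadratic_split_not_dvd_classNumber : Prop :=
  ∀ (ℓ : ℕ), ℓ.Prime → ∀ (S : Finset ℕ), (∀ q ∈ S, q.Prime ∧ q ≠ 2) →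
    ∃ (K : Type) (_ : Field K) (_ : NumberField K), IsImaginaryQuadratic K ∧
      (∀ q ∈ S, ((Ideal.span {(q : ℤ)}).primesOver (𝓞 K)).ncard = 2) ∧
      ¬ ℓ ∣ NumberField.classNumber K

/-- **Corollary (Heegner-hypothesis form).** For a prime `ℓ` and an ODD level `N ≠ 0`, there is an
imaginary quadratic `K` satisfying the Heegner hypothesis for `N` (every prime factor of `N` splits)
with `ℓ ∤ h_K` — Theorem 1 applied to `S₊ =` the set of prime factors of `N`.
[cite: BeckwithRaumRichter2024, Theorem 1] -/
theorem exists_heegnerField_not_dvd_classNumber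
    (h : thm1_exists_imaginaryQuadratic_split_not_dvd_classNumber) {ℓ : ℕ} (hℓ : ℓ.Prime) {N : ℕ}
    (hN : Odd N) :
    ∃ (K : Type) (_ : Field K) (_ : NumberField K), IsImaginaryQuadratic K ∧
      SatisfiesHeegnerHypothesis N K ∧ ¬ ℓ ∣ NumberField.classNumber K := by
  have hS : ∀ q ∈ N.primeFactors, q.Prime ∧ q ≠ 2 := by
    intro q hq
    have hqp : q.Prime := Nat.prime_of_mem_primeFactors hq
    refine ⟨hqp, ?_⟩
    rintro rfl
    have h2 : 2 ∣ N := Nat.dvd_of_mem_primeFactors hq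
    exact (Nat.not_even_iff_odd.mpr hN) (even_iff_two_dvd.mpr h2)
  obtain ⟨K, iF, iN, hK, hsplit, hcl⟩ := h ℓ hℓ N.primeFactors hS
  refine ⟨K, iF, iN, hK, ?_, hcl⟩
  intro q hq hqN
  have hN0 : N ≠ 0 := by
    rintro rfl
    exact (Nat.not_even_iff_odd.mpr hN) (by decide)
  exact hsplit q (Nat.mem_primeFactors.mpr ⟨hq, hqN, hN0⟩)

/-- **Corollary (Heegner hypothesis for `N` together with a further odd prime `p` split).** For a
prime `ℓ`, an ODD level `N ≠ 0` and an ODD prime `p`, there is an imaginary quadratic `K` with every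
prime factor of `N` split, `p` split, and `ℓ ∤ h_K` — Theorem 1 with `S₊ = primeFactors(N) ∪ {p}`
(the shape consumed by the Eisenstein-prime roads: `K` admissible for `N_E`, `p` split in `K`,
`p ∤ h_K`; take `ℓ = p`). [cite: BeckwithRaumRichter2024, Theorem 1] -/
theorem exists_heegnerField_split_not_dvd_classNumber
    (h : thm1_exists_imaginaryQuadratic_split_not_dvd_classNumber) {ℓ : ℕ} (hℓ : ℓ.Prime) {N : ℕ}
    (hN : Odd N) {p : ℕ} (hp : p.Prime) (hp2 : p ≠ 2) :
    ∃ (K : Type) (_ : Field K) (_ : NumberField K), IsImaginaryQuadratic K ∧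
      SatisfiesHeegnerHypothesis N K ∧ SatisfiesHeegnerHypothesis p K ∧
      ¬ ℓ ∣ NumberField.classNumber K := by
  have hNp : Odd (N * p) := hN.mul (hp.odd_of_ne_two hp2)
  obtain ⟨K, iF, iN, hK, hH, hcl⟩ := exists_heegnerField_not_dvd_classNumber h hℓ hNp
  exact ⟨K, iF, iN, hK, hH.of_dvd (Dvd.intro p rfl), hH.of_dvd (Dvd.intro_left N rfl), hcl⟩

end Literature.NumberTheory.QuadraticFields.BeckwithRaumRichter2024
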